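import Summits.Schanuel.Schanuel.Theorems.SoloInformedRoyAlgebraicAxis
import Literature.NumberTheory.Transcendental.RoyCriterionProp3Proofs
import Summits.Schanuel.Schanuel.Statement

/-!
# Schanuel (rank `l`) ⟺ Roy's criterion at tuples whose every axis carries a transcendental number

By `not_royHypothesis_of_algebraic_axis` (file `SoloInformedRoyAlgebraicAxis`: Philippon's zero
estimate + Liouville's inequality) the hypothesis of Roy's Conjecture 2 fails at every tuple
`(y, α)` having an axis `j` with `y_j, α_j` both algebraic (`y_j, α_j ≠ 0`).  Hence the
implication asked for by `RoyCriterion l` only has content at tuples such that on EVERY axis at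
least one of `y_j, α_j` is transcendental:

* `not_royHypothesis_of_isAlgebraic_axis` — the `IsAlgebraic ℚ` form of the algebraic-axis
  obstruction (the number field is `ℚ(y_j, α_j) ⊂ ℂ`);
* `royCriterion_iff_transcendental_axes` — `RoyCriterion l` is equivalent to its restriction to
  tuples with `∀ j, IsAlgebraic ℚ (y j) → Transcendental ℚ (α j)`;
* `schanuelRank_iff_royCriterion_transcendental_axes` — combined with Roy's equivalence
  (`Roy2001_iff_holds`, tree): Schanuel's conjecture for rank `l` is equivalent to Roy's small
  value criterion AT TRANSCENDENTAL-AXIS TUPLES ONLY; and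
  `schanuel_iff_forall_transcendental_axes` for the summit constant `Schanuel`
  (`= Literature.Periods.SchanuelConjecture`, definitionally `∀ l, SchanuelRank l`).

Atlas reading (solo seat `solo-Schanuel-informed`, §3 S2 (s5) door table): the missing small value
estimate must act at transcendental points; at algebraic axes Waldschmidt's construction
threshold and Liouville's obstruction coincide and nothing is asked.  No step toward the
conjecture is claimed.
-/

open MvPolynomial Filter Complex
open Literature.NumberTheory.Transcendental

namespace Summit.Schanuel.Schanuel.Theorems

/-- `IsAlgebraic` form: if `y_j ≠ 0` and `α_j ≠ 0` are both algebraic, the hypothesis of Roy's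
Conjecture 2 fails for every admissible parameter set (take `K = ℚ(y_j, α_j)`).
[cite: Roy2001, Conjecture 2; BakerTNT1975, Ch. 1 Thm. 1.2] -/
theorem not_royHypothesis_of_isAlgebraic_axis {l : ℕ} {y α : Fin l → ℂ} {s₀ s₁ t₀ t₁ u : ℝ}
    (hadm : RoyAdmissible s₀ s₁ t₀ t₁ u) (j : Fin l) (hy : y j ≠ 0) (hα : α j ≠ 0)
    (hyalg : IsAlgebraic ℚ (y j)) (hαalg : IsAlgebraic ℚ (α j)) :
    ¬ RoyHypothesis y α s₀ s₁ t₀ t₁ u := by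
  set F : IntermediateField ℚ ℂ := IntermediateField.adjoin ℚ {y j, α j} with hF
  have hfin : FiniteDimensional ℚ F := by
    rw [hF]
    apply IntermediateField.finiteDimensional_adjoin
    intro x hx
    rcases hx with rfl | hx
    · exact hyalg.isIntegral
    · rw [Set.mem_singleton_iff] at hx
      rw [hx]
      exact hαalg.isIntegral
  haveI : NumberField F := NumberField.mk
  have hyF : y j ∈ F := IntermediateField.subset_adjoin ℚ _ (by simp)
  have hαF : α j ∈ F := IntermediateField.subset_adjoin ℚ _ (by simp)
  exact not_royHypothesis_of_algebraic_axis hadm F.val.toRingHom j ⟨y j, hyF⟩ ⟨α j, hαF⟩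
    rfl rfl hy hα

/-- **Roy's criterion lives at transcendental-axis tuples.** `RoyCriterion l` is equivalent to
its restriction to tuples `(y, α)` such that on every axis at least one of `y_j`, `α_j` is
transcendental. [cite: Roy2001, Conjecture 2] -/
theorem royCriterion_iff_transcendental_axes (l : ℕ) :
    RoyCriterion l ↔
      ∀ (y α : Fin l → ℂ), LinearIndependent ℚ y → (∀ j, α j ≠ 0) →
        (∀ j, IsAlgebraic ℚ (y j) → Transcendental ℚ (α j)) →
        ∀ (s₀ s₁ t₀ t₁ u : ℝ), RoyAdmissible s₀ s₁ t₀ t₁ u → RoyHypothesis y α s₀ s₁ t₀ t₁ u →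
          (l : Cardinal) ≤ Algebra.trdeg ℚ
            ↥(IntermediateField.adjoin ℚ (Set.range y ∪ Set.range α)) := by
  refine ⟨fun h y α hy hα _ => h y α hy hα, fun h y α hy hα s₀ s₁ t₀ t₁ u hadm hhyp => ?_⟩
  by_cases htr : ∀ j, IsAlgebraic ℚ (y j) → Transcendental ℚ (α j)
  · exact h y α hy hα htr s₀ s₁ t₀ t₁ u hadm hhyp
  · push Not at htr
    obtain ⟨j, hyalg, hαalg⟩ := htr
    exact (not_royHypothesis_of_isAlgebraic_axis hadm j (hy.ne_zero j) (hα j) hyalg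
      (by simpa [Transcendental] using hαalg) hhyp).elim

/-- **Schanuel (rank `l`) ⟺ Roy's small value criterion at transcendental-axis tuples only.**
[cite: Roy2001, Thm. (Conjecture 1 ⟺ Conjecture 2), §5] -/
theorem schanuelRank_iff_royCriterion_transcendental_axes (l : ℕ) :
    SchanuelRank l ↔
      ∀ (y α : Fin l → ℂ), LinearIndependent ℚ y → (∀ j, α j ≠ 0) →
        (∀ j, IsAlgebraic ℚ (y j) → Transcendental ℚ (α j)) →
        ∀ (s₀ s₁ t₀ t₁ u : ℝ), RoyAdmissible s₀ s₁ t₀ t₁ u → RoyHypothesis y α s₀ s₁ t₀ t₁ u →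
          (l : Cardinal) ≤ Algebra.trdeg ℚ
            ↥(IntermediateField.adjoin ℚ (Set.range y ∪ Set.range α)) :=
  ((Roy2001_iff_holds l).symm).trans (royCriterion_iff_transcendental_axes l)

/-- Summit-shaped form: `Schanuel` (`= Literature.Periods.SchanuelConjecture`, definitionally
`∀ l, SchanuelRank l`) is equivalent to Roy's criterion for all ranks at transcendental-axis
tuples. [cite: Roy2001, §5] -/
theorem schanuel_iff_forall_transcendental_axes :
    Schanuel ↔
      ∀ (l : ℕ) (y α : Fin l → ℂ), LinearIndependent ℚ y → (∀ j, α j ≠ 0) →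
        (∀ j, IsAlgebraic ℚ (y j) → Transcendental ℚ (α j)) →
        ∀ (s₀ s₁ t₀ t₁ u : ℝ), RoyAdmissible s₀ s₁ t₀ t₁ u → RoyHypothesis y α s₀ s₁ t₀ t₁ u →
          (l : Cardinal) ≤ Algebra.trdeg ℚ
            ↥(IntermediateField.adjoin ℚ (Set.range y ∪ Set.range α)) := by
  show (∀ l, SchanuelRank l) ↔ _
  exact ⟨fun h l => (schanuelRank_iff_royCriterion_transcendental_axes l).1 (h l),
    fun h l => (schanuelRank_iff_royCriterion_transcendental_axes l).2 (h l)⟩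

end Summit.Schanuel.Schanuel.Theorems
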